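import Literature.NumberTheory.EllipticCurves.ModularParametrizationDegreeProofs
import Literature.NumberTheory.EllipticCurves.ModularParametrizationDegreeCongruenceProofs
import Literature.NumberTheory.EllipticCurves.PeriodLatticeRationalityUnconditionalProofs
import Literature.NumberTheory.EllipticCurves.EichlerShimuraConstructionLatticeProofs
import Literature.NumberTheory.EllipticCurves.GlobalMinimalModelProofs
import Literature.NumberTheory.EllipticCurves.IsogenyVariableChangeProofs
import HarnessLib

/-!
# `IsNewformOf.exists_maninConstant_modularDegree`: its residual is exactly
# `IsNewformOf.exists_maninConstant_ne_zero`

Topic `NumberTheory/EllipticCurves`; a proofs-only companion (theorems only: no definitions, no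
named facts, nothing restated; D-0026) of `ModularParametrization.lean`, written by the seat of
its named fact `IsNewformOf.exists_maninConstant_modularDegree` — for a globally minimal model
`W/ℚ` with newform `f ∈ S₂(Γ₀(N))` (`IsNewformOf W f`) and a Néron-type period pair `L` of `W`,
an integer `c` with `c Λ_f ⊆ Λ_L` and a degree `d ≥ 1` such that
`Γ₀(N)τ ↦ c · 2πi ∫_{i∞}^τ f (mod Λ_L)` has exactly `d` orbits in all but finitely many fibres
(Breuil–Conrad–Diamond–Taylor 2001, Thm. A in the form (6) of p. 845, made analytic on `ℂ/Λ_E`;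
"(2) ⇒ (6) follows from a construction of Shimura [Sh2] and a theorem of Faltings [Fa1]").

State of the tree. `ModularParametrizationDegreeProofs.lean` proved the Riemann-surface half
(`exists_modularDegree_holds`: for *every* `c ≠ 0` with `c Λ_f ⊆ Λ` the map `Y₀(N) → ℂ/Λ` has a
degree) and hence the fact from its arithmetic half `IsNewformOf.exists_maninConstant_ne_zero`
(`c ≠ 0`, `c Λ_f ⊆ Λ_L`; `exists_maninConstant_modularDegree_of_ne_zero`). This file proves the
converse and records the consequence:

* `not_finite_quotient_periodPairLattice` — `ℂ/Λ` is infinite for a period lattice `Λ` (a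
  subgroup of finite index `n` would contain `n • (ω₁/2n) = ω₁/2`).
* `exists_maninConstant_ne_zero_of_exists_maninConstant_modularDegree` — the fact implies
  `IsNewformOf.exists_maninConstant_ne_zero` for *every* elliptic `W/ℚ` (not only globally
  minimal ones): pass to a global minimal model `C • W` (`hasGlobalMinimalModel_rat_holds`,
  Silverman *AEC* VIII.8.3), which has the same newform (`LFunction_smul`) and a Néron-type
  lattice `Λ'` (`exists_isNeronLatticeOf_holds`, *AEC* VI.5.1); the fact gives `c Λ_f ⊆ Λ'` with a
  degree `d ≥ 1`, and `c ≠ 0` because for `c = 0` every `P ≠ 0` of the infinite group `ℂ/Λ'` has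
  an empty fibre; finally `a Λ' ⊆ Λ_L`, `a ∈ ℤ ∖ {0}`, along `C • W ~ W`
  (`isIsogenous_of_smul`, `neronLattice_commensurable_of_isIsogenous_holds`, *AEC* VI.4.1, VI.5.3).
* `exists_maninConstant_modularDegree_iff_exists_maninConstant_ne_zero` — hence the two named
  facts are **equivalent, unconditionally**: the degree clause and the restriction to globally
  minimal models carry no content beyond `c ≠ 0`. In particular the open content of this fact is
  *exactly* that of `IsNewformOf.exists_maninConstant_ne_zero`, which
  `ModularParametrizationDegreeCongruenceProofs.lean` reduced to Deligne–Serre 1974, (2.7.2) in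
  the weights `≥ 12` (`DeligneSerre1974_span_integralLattice1`), the Eichler–Shimura congruence
  relation for the curve `y² = x³ - (g₂(Λ_f)/4)x - g₃(Λ_f)/4` (cofinite form, Shimura 1971,
  Thm. 7.15) and Faltings' isogeny theorem (`WeierstrassCurve.isIsogenous_iff_frobeniusTrace_eq`):
* `exists_maninConstant_modularDegree_of_congruence_cofinite`,
  `exists_maninConstant_modularDegree_of_congruence` — the fact from those three inputs.
* `exists_maninConstant_modularDegree_of_congruenceRelation_cofinite`,
  `exists_maninConstant_modularDegree_of_congruenceRelation` — the first of the three inputs has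
  since been removed upstream: the rationality of `g₂(Λ_f), g₃(Λ_f)` is now unconditional
  (`PeriodLatticeRationalityUnconditionalProofs.lean`, via Shimura's Thm. 3.52 for `Γ₀(N)`,
  `CuspFormsGamma0IntegralBasisProofs`; and (2.7.2) itself is meanwhile a theorem of the tree,
  `DeligneSerre1974_span_integralLattice1_holds`), so this fact — like its arithmetic half
  (`exists_maninConstant_ne_zero_of_congruenceRelation[_cofinite]`) and BCDT's (6)
  (`nonempty_modularParametrizationData_of_congruenceRelation`) — rests on exactly **two** inputs:
  the Eichler–Shimura congruence relation `a_p(f) = a_p(ℂ/Λ_f)` (cofinitely, Shimura 1971,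
  Thm. 7.15; or at all `p ∤ N`, Knapp 1993, Thm. 11.74 (e)) and Faltings' isogeny theorem.

Nothing is discharged here; no statement of the tree is changed; no definition and no named fact
is added.

## References

* C. Breuil, B. Conrad, F. Diamond, R. Taylor, *On the modularity of elliptic curves over `ℚ`:
  wild 3-adic exercises*, J. Amer. Math. Soc. 14 (2001), 843–939: Thm. A; p. 845, conditions
  (1)–(6) and "(2) ⇒ (6)" (PDF p. 4 of the held DASH copy). [BCDTJAMS2001]
* A. W. Knapp, *Elliptic Curves*, Math. Notes 40, Princeton 1993: Thm. 11.74 (d), (e) with the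
  Remarks (PDF p. 287); Thm. 12.8 (PDF p. 301). [Knapp1993]
* G. Shimura, *Introduction to the arithmetic theory of automorphic functions*, Princeton 1971:
  Thm. 7.14, Thm. 7.15 (PDF p. 212). [ShimuraIATAF1971]
* P. Deligne, J.-P. Serre, *Formes modulaires de poids 1*, Ann. Sci. ÉNS 7 (1974): (2.7.2).
  [DeligneSerreASENS1974]
* G. Faltings, *Endlichkeitssätze für abelsche Varietäten über Zahlkörpern*, Invent. Math. 73
  (1983): §5, Korollar 2. [Faltings1983Endlichkeit]
* J. H. Silverman, *The Arithmetic of Elliptic Curves*, 2nd ed., GTM 106, Springer 2009: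
  Thm. VI.4.1, Thm. VI.5.1, Thm. VI.5.3, Cor. VIII.8.3. [SilvermanAEC2009]
-/

noncomputable section

open scoped MatrixGroups ModularForm

open CongruenceSubgroup UpperHalfPlane PowerSeries

namespace Literature.NumberTheory.EllipticCurves.ModularForms

/-! ### `ℂ/Λ` is infinite -/

/-- For a period pair `L`, the torus `ℂ/Λ_L` is not finite: a subgroup `Λ` of finite index `n`
in `ℂ` contains `n • z` for every `z`, in particular `n • (ω₁/(2n)) = ω₁/2`, but `ω₁/2 ∉ Λ`
(`PeriodPair.ω₁_div_two_notMem_lattice`). [folklore] -/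
theorem not_finite_quotient_periodPairLattice (L : PeriodPair) :
    ¬ Finite (ℂ ⧸ L.lattice.toAddSubgroup) := by
  intro hfin
  set Λ : AddSubgroup ℂ := L.lattice.toAddSubgroup with hΛ
  have hidx : Λ.index ≠ 0 := AddSubgroup.index_ne_zero_of_finite
  have hmem : Λ.index • (L.ω₁ / (2 * (Λ.index : ℂ))) ∈ Λ := Λ.nsmul_index_mem _
  have hcalc : Λ.index • (L.ω₁ / (2 * (Λ.index : ℂ))) = L.ω₁ / 2 := by
    rw [nsmul_eq_mul]
    have h0 : (Λ.index : ℂ) ≠ 0 := by exact_mod_cast hidx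
    field_simp
  rw [hcalc] at hmem
  exact L.ω₁_div_two_notMem_lattice hmem

/-! ### The arithmetic half back from the composite fact -/

/-- **`IsNewformOf.exists_maninConstant_ne_zero` from
`IsNewformOf.exists_maninConstant_modularDegree`.** Given an elliptic `W/ℚ` with newform `f`
and a Néron-type period pair `L` of `W`: choose a global minimal model `C • W`
(`hasGlobalMinimalModel_rat_holds`, Silverman *AEC* VIII.8.3); `f` is its newform too
(`LFunction_smul`), and it has a Néron-type period pair `L'` (`exists_isNeronLatticeOf_holds`,
*AEC* VI.5.1). The composite fact at `(C • W, f, L')` gives `c ∈ ℤ` with `c Λ_f ⊆ Λ_{L'}` and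
`d ≥ 1` with all but finitely many fibres of `Γ₀(N)τ ↦ c · 2πi∫_{i∞}^τ f (mod Λ_{L'})` of size
`d`. Here `c ≠ 0`: for `c = 0` the map is constant `= 0`, so every `P ≠ 0` has an empty fibre
(`0 ≠ d` orbits) and the exceptional set would contain the complement of `{0}` in the infinite
group `ℂ/Λ_{L'}` (`not_finite_quotient_periodPairLattice`). Finally `C • W ~ W` over `ℚ`
(`isIsogenous_of_smul`), so `a Λ_{L'} ⊆ Λ_L` for an integer `a ≠ 0`
(`neronLattice_commensurable_of_isIsogenous_holds`, *AEC* VI.4.1, VI.5.3 with III.5), and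
`(a c) Λ_f ⊆ Λ_L`. [cite: BCDTJAMS2001, p. 845, "(2) ⇒ (6)"]
[cite: SilvermanAEC2009, Cor. VIII.8.3, Thm. VI.5.1, Thm. VI.4.1 and Thm. VI.5.3] -/
theorem exists_maninConstant_ne_zero_of_exists_maninConstant_modularDegree
    (h : IsNewformOf.exists_maninConstant_modularDegree) :
    IsNewformOf.exists_maninConstant_ne_zero := by
  intro W _ N _ f hf L hL
  obtain ⟨C, hC⟩ := WeierstrassCurve.hasGlobalMinimalModel_rat_holds W
  haveI := hC
  have hf' : IsNewformOf (C • W) f :=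
    ⟨hf.1, fun n ↦ by rw [hf.2 n, WeierstrassCurve.LFunction_smul]⟩
  haveI : ((C • W).baseChange ℂ).IsElliptic := by
    rw [WeierstrassCurve.baseChange]; infer_instance
  obtain ⟨L', hL'⟩ := exists_isNeronLatticeOf_holds ((C • W).baseChange ℂ)
  obtain ⟨c, hc, d, hd, hfin⟩ := h hf' hL'
  have hc0 : c ≠ 0 := by
    rintro rfl
    apply not_finite_quotient_periodPairLattice L'
    have hsub : {P : ℂ ⧸ L'.lattice.toAddSubgroup | P ≠ 0} ⊆
        {P : ℂ ⧸ L'.lattice.toAddSubgroup |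
          Nat.card {y : Y0 N // ∃ τ : ℍ, Y0.mk N τ = y ∧
            (((((0 : ℤ) : ℂ) * eichlerIntegral f τ : ℂ) : ℂ ⧸ L'.lattice.toAddSubgroup)) = P} ≠
            d} := by
      intro P hP
      simp only [Set.mem_setOf_eq] at hP ⊢
      haveI : IsEmpty {y : Y0 N // ∃ τ : ℍ, Y0.mk N τ = y ∧
          (((((0 : ℤ) : ℂ) * eichlerIntegral f τ : ℂ) : ℂ ⧸ L'.lattice.toAddSubgroup)) = P} := by
        refine ⟨fun y ↦ ?_⟩
        obtain ⟨τ, _, hτ⟩ := y.2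
        apply hP
        rw [← hτ, Int.cast_zero, zero_mul, QuotientAddGroup.mk_zero]
      rw [Nat.card_of_isEmpty]
      exact (Nat.pos_iff_ne_zero.mp hd).symm
    have huniv : (Set.univ : Set (ℂ ⧸ L'.lattice.toAddSubgroup)).Finite := by
      refine ((hfin.subset hsub).union (Set.finite_singleton 0)).subset ?_
      intro P _
      by_cases hP : P = 0
      · exact Or.inr hP
      · exact Or.inl hP
    exact Set.finite_univ_iff.mp huniv
  obtain ⟨a, ha0, ha⟩ := neronLattice_commensurable_of_isIsogenous_holds
    (WeierstrassCurve.isIsogenous_of_smul W C) hL' hL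
  refine ⟨a * c, mul_ne_zero ha0 hc0, fun z hz ↦ ?_⟩
  rw [Int.cast_mul, mul_assoc]
  exact ha _ (hc z hz)

/-- **The composite fact and its arithmetic half are equivalent** (unconditionally): the degree
clause of `IsNewformOf.exists_maninConstant_modularDegree` is the tree's theorem
`exists_modularDegree_holds` (`exists_maninConstant_modularDegree_of_ne_zero`), and conversely
`exists_maninConstant_ne_zero_of_exists_maninConstant_modularDegree`. So what remains to be
proved of either fact is the same: the Eichler–Shimura construction with the rational Manin
constant and Faltings' isogeny theorem ("(2) ⇒ (6)", Breuil–Conrad–Diamond–Taylor 2001, p. 845).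
[cite: BCDTJAMS2001, p. 845, "(2) ⇒ (6)"] -/
theorem exists_maninConstant_modularDegree_iff_exists_maninConstant_ne_zero :
    IsNewformOf.exists_maninConstant_modularDegree ↔ IsNewformOf.exists_maninConstant_ne_zero :=
  ⟨exists_maninConstant_ne_zero_of_exists_maninConstant_modularDegree,
    exists_maninConstant_modularDegree_of_ne_zero⟩

/-! ### The fact from (2.7.2), the congruence relation and Faltings -/

/-- **`IsNewformOf.exists_maninConstant_modularDegree` from Deligne–Serre (2.7.2), the cofinite
Eichler–Shimura congruence relation and Faltings' isogeny theorem** — the sharpest reduction the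
tree offers (`exists_maninConstant_ne_zero_of_congruence_cofinite` of
`ModularParametrizationDegreeCongruenceProofs.lean` with
`exists_maninConstant_modularDegree_of_ne_zero`). Hypotheses: `hDS` — (2.7.2) at every level in
the weights `k ≥ 12` (the tree's named fact `DeligneSerre1974_span_integralLattice1 N k`); `hC` —
for every newform `f ∈ S₂(Γ₀(N))` with `K_f = ℚ`, every period pair `L` spanning `Λ_f` and all
`a₄, a₆ ∈ ℚ` with `(g₂(L), g₃(L)) = (-4a₄, -4a₆)`, `a_p(f) = a_p(y² = x³ + a₄x + a₆)` for all but
finitely many primes `p` (Shimura 1971, Thm. 7.15; Knapp 1993, Thm. 11.74 (e)); `hF` — Faltings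
1983, §5 Kor. 2 in the tree's form. [cite: BCDTJAMS2001, p. 845, "(2) ⇒ (6)"]
[cite: ShimuraIATAF1971, Thm. 7.14 and Thm. 7.15 (PDF p. 212)]
[cite: Faltings1983Endlichkeit, §5 Korollar 2 (i) ⟺ (iii)] -/
theorem exists_maninConstant_modularDegree_of_congruence_cofinite
    (hDS : ∀ (N : ℕ) [NeZero N] (k : ℤ), 12 ≤ k → DeligneSerre1974_span_integralLattice1 N k)
    (hC : ∀ (N : ℕ) [NeZero N] (f : CuspForm (Gamma0 N) 2), IsNewform0 f → coeffField f = ⊥ →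
      ∀ (L : PeriodPair), L.lattice.toAddSubgroup = periodLattice f →
        ∀ a₄ a₆ : ℚ, L.g₂ = -4 * (a₄ : ℂ) → L.g₃ = -4 * (a₆ : ℂ) →
          {p : ℕ | p.Prime ∧ (qExpansion 1 ⇑f).coeff p ≠
            (({ a₁ := 0, a₂ := 0, a₃ := 0, a₄ := a₄, a₆ := a₆ } : WeierstrassCurve ℚ).LFunction
              p : ℂ)}.Finite)
    (hF : WeierstrassCurve.isIsogenous_iff_frobeniusTrace_eq) :
    IsNewformOf.exists_maninConstant_modularDegree :=
  exists_maninConstant_modularDegree_of_ne_zero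
    (exists_maninConstant_ne_zero_of_congruence_cofinite hDS hC hF)

/-- The same with the congruence relation at the primes `p ∤ N` (Knapp 1993, Thm. 11.74 (e) with
the Remark on Igusa, PDF p. 287), via `exists_maninConstant_ne_zero_of_congruence`.
[cite: Knapp1993, Thm. 11.74 (d), (e) with Remarks (PDF p. 287)]
[cite: BCDTJAMS2001, p. 845, "(2) ⇒ (6)"] -/
theorem exists_maninConstant_modularDegree_of_congruence
    (hDS : ∀ (N : ℕ) [NeZero N] (k : ℤ), 12 ≤ k → DeligneSerre1974_span_integralLattice1 N k)
    (hC : ∀ (N : ℕ) [NeZero N] (f : CuspForm (Gamma0 N) 2), IsNewform0 f → coeffField f = ⊥ →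
      ∀ (L : PeriodPair), L.lattice.toAddSubgroup = periodLattice f →
        ∀ a₄ a₆ : ℚ, L.g₂ = -4 * (a₄ : ℂ) → L.g₃ = -4 * (a₆ : ℂ) →
          ∀ p : ℕ, p.Prime → ¬ p ∣ N →
            (qExpansion 1 ⇑f).coeff p =
              (({ a₁ := 0, a₂ := 0, a₃ := 0, a₄ := a₄, a₆ := a₆ } : WeierstrassCurve ℚ).LFunction
                p : ℂ))
    (hF : WeierstrassCurve.isIsogenous_iff_frobeniusTrace_eq) :
    IsNewformOf.exists_maninConstant_modularDegree :=
  exists_maninConstant_modularDegree_of_ne_zero (exists_maninConstant_ne_zero_of_congruence hDS hC hF)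

/-! ### The fact from the congruence relation and Faltings alone -/

/-- **`IsNewformOf.exists_maninConstant_modularDegree` from the cofinite Eichler–Shimura
congruence relation and Faltings' isogeny theorem** — the two inputs of "(2) ⇒ (6)"
(Breuil–Conrad–Diamond–Taylor 2001, p. 845: "follows from a construction of Shimura [Sh2] and a
theorem of Faltings [Fa1]") that the tree has not proved; everything else of Shimura's
construction (`Λ_f` a lattice with rational invariants, the Néron lattice of `ℂ/Λ_f`, the degree
of `Y₀(N) → ℂ/Λ`) is a theorem of the tree.  Hypotheses: `hC` — for every newform
`f ∈ S₂(Γ₀(N))` with `K_f = ℚ`, every period pair `L` spanning `Λ_f` and all `a₄, a₆ ∈ ℚ` with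
`(g₂(L), g₃(L)) = (-4a₄, -4a₆)`, `a_p(f) = a_p(y² = x³ + a₄x + a₆)` for all but finitely many
primes `p` (Shimura 1971, Thm. 7.15: the zeta function of the abelian variety attached to `f`
"coincides, up to a finite number of Euler factors, with" `L(s, f)`); `hF` — Faltings 1983, §5
Kor. 2 in the tree's form `WeierstrassCurve.isIsogenous_iff_frobeniusTrace_eq`.  Proof:
`exists_maninConstant_ne_zero_of_congruenceRelation_cofinite`
(`PeriodLatticeRationalityUnconditionalProofs`) and `exists_maninConstant_modularDegree_of_ne_zero`.
[cite: BCDTJAMS2001, p. 845, "(2) ⇒ (6)"] [cite: ShimuraIATAF1971, Thm. 7.14 and Thm. 7.15 (PDF p. 212)]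
[cite: Faltings1983Endlichkeit, §5 Korollar 2 (i) ⟺ (iii)] -/
theorem exists_maninConstant_modularDegree_of_congruenceRelation_cofinite
    (hC : ∀ (N : ℕ) [NeZero N] (f : CuspForm (Gamma0 N) 2), IsNewform0 f → coeffField f = ⊥ →
      ∀ (L : PeriodPair), L.lattice.toAddSubgroup = periodLattice f →
        ∀ a₄ a₆ : ℚ, L.g₂ = -4 * (a₄ : ℂ) → L.g₃ = -4 * (a₆ : ℂ) →
          {p : ℕ | p.Prime ∧ (qExpansion 1 ⇑f).coeff p ≠
            (({ a₁ := 0, a₂ := 0, a₃ := 0, a₄ := a₄, a₆ := a₆ } : WeierstrassCurve ℚ).LFunction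
              p : ℂ)}.Finite)
    (hF : WeierstrassCurve.isIsogenous_iff_frobeniusTrace_eq) :
    IsNewformOf.exists_maninConstant_modularDegree :=
  exists_maninConstant_modularDegree_of_ne_zero
    (exists_maninConstant_ne_zero_of_congruenceRelation_cofinite hC hF)

/-- **`IsNewformOf.exists_maninConstant_modularDegree` from the Eichler–Shimura congruence
relation at the primes `p ∤ N` and Faltings' isogeny theorem** (Knapp 1993, Thm. 11.74 (e) with
the Remark on Igusa's theorem, PDF p. 287: `a_p(f) = a_p(E)` for every `p ∤ N`); via
`exists_maninConstant_ne_zero_of_congruenceRelation` and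
`exists_maninConstant_modularDegree_of_ne_zero`.
[cite: Knapp1993, Thm. 11.74 (d), (e) with Remarks (PDF p. 287)]
[cite: BCDTJAMS2001, p. 845, "(2) ⇒ (6)"] [cite: Faltings1983Endlichkeit, §5 Korollar 2 (i) ⟺ (iii)] -/
theorem exists_maninConstant_modularDegree_of_congruenceRelation
    (hC : ∀ (N : ℕ) [NeZero N] (f : CuspForm (Gamma0 N) 2), IsNewform0 f → coeffField f = ⊥ →
      ∀ (L : PeriodPair), L.lattice.toAddSubgroup = periodLattice f →
        ∀ a₄ a₆ : ℚ, L.g₂ = -4 * (a₄ : ℂ) → L.g₃ = -4 * (a₆ : ℂ) →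
          ∀ p : ℕ, p.Prime → ¬ p ∣ N →
            (qExpansion 1 ⇑f).coeff p =
              (({ a₁ := 0, a₂ := 0, a₃ := 0, a₄ := a₄, a₆ := a₆ } : WeierstrassCurve ℚ).LFunction
                p : ℂ))
    (hF : WeierstrassCurve.isIsogenous_iff_frobeniusTrace_eq) :
    IsNewformOf.exists_maninConstant_modularDegree :=
  exists_maninConstant_modularDegree_of_ne_zero (exists_maninConstant_ne_zero_of_congruenceRelation hC hF)

end Literature.NumberTheory.EllipticCurves.ModularForms

end
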